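import Literature.NumberTheory.EllipticCurves.Fouquet2025.CongruenceTransportFromSeedMainIdentitySigma
import Literature.NumberTheory.EllipticCurves.CyclotomicIwasawaMainTheoremIrreducibleIntegral
import HarnessLib

/-!
# Fouquet 2025 (Tunisian J. Math. 7), Thm 4.1 (1) ⇒ (2) with Burungale–Castella–Skinner 2025 Thm 1.1.2 (b)
# AT THE SEED: the `p`-part of BSD in analytic rank `0` for a target of ANY reduction at `p ≥ 5` from a
# congruent good-ordinary partner with big `p`-adic image — NO ramified Steinberg prime and NO unit
# `L`-value required anywhere (THEOREMS ONLY; no new fact, no definition)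

Topic `NumberTheory/EllipticCurves`, sub-directory `Fouquet2025` (namespace = path). Written by the typer
seat `bsd-littype-07` (gen 3) of the cross-ladder literature-typing layer (D-0088(4); cell
`run/shared/lean/pub/bsd-littype/`). THEOREMS ONLY over named facts ALREADY in the tree: the two Fouquet
transport facts with the seed's assertion (1) supplied as a hypothesis —
`Fouquet2025.padicValRat_bsd_rank_zero_of_congruence_of_seedMainIdentity` (A′, strict `Σ`, p466456) and
`Fouquet2025.padicValRat_bsd_rank_zero_of_congruence_of_seedMainIdentity_sigma` (A′σ, `Σ = primes(p·N_W·N_G)`,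
p467398) — and the Burungale–Castella–Skinner fact
`burungale_castella_skinner_charIdeal_eq_padicLFunction_integral` (IMRN 2025 rnaf082 Thm 1.1.2 (b), file
`CyclotomicIwasawaMainTheoremIrreducibleIntegral.lean`). No `sorry`, no new `def`, no instance, no notation.

WHY THIS FILE (the printed mechanism, and what it buys the census). Fouquet's Thm 4.1 asks, as assertion
(1), for ONE motivic point `λ` of `T^Σ_𝔪ρ̄` at which the zeta morphism `z(λ)_Iw` is an isomorphism — of ANY
provenance ("Attentive readers will notice that the full strength of theorem 4.1 is used only once in the
proof: to ensure that the Iwasawa Main Conjecture is true for the second eigencuspform `g`. When this is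
known beforehand — for instance because the hypotheses of [14, Theorem 1.1] or the hypotheses of [16,
Theorem 1.7] are satisfied — then the assumptions of the corollary may be relaxed accordingly", p. 25
L43–L46 [corpus:paper-arxiv-2501.07105 p0025]). For a good-ORDINARY elliptic seed `G` with `ρ_{G,p^∞}`
onto, assertion (1) at `λ_G` is Kato's Conj. 12.10 for `T_pG`, equivalently (Kato §17.13, pp. 279–280,
`p ≠ 2`, (12.5.2)) the integral cyclotomic main identity `char_Λ X(G/ℚ_∞) = (L_p(G,T))` — the tree's
predicate `Sakamoto2024.CyclotomicMainIdentityAt G p g` that (A′)/(A′σ) take as a hypothesis. The earlier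
roads of this directory supply that identity from Skinner–Urban 2014 Thm 3.6.9 (bsd.S21: needs a prime
`ℓ ∥ N_G` with `ρ̄` RAMIFIED — and since `ρ̄ = W[p] ≅ G[p]`, such a prime is then a multiplicative prime
of the TARGET with `p ∤ v_ℓ(Δ_min(W))` as well, so the Skinner–Urban road never reaches a target without
a ramified Steinberg prime) or from Kato's Thm 17.4 (3) with a UNIT `p`-adic `L`-function (bsd.S20; inert
on every census row with `p ∣ #Ш_an(W)` by Vatsal's congruence of algebraic special values, as the
consumer cell `bsd-potss` observed, UNITSEED-SCREEN 2026-08-26). Burungale–Castella–Skinner 2025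
Thm 1.1.2 (b) REMOVES the ramified-prime hypothesis: for `p ≥ 5` good ordinary, `G[p]` irreducible and
`ρ_{G,p}` onto `GL₂(ℤ_p)` (the tree's special case of their (im)), `char_Λ X(G/ℚ_∞) = (L_p(G,T))` in `Λ`
— exactly `Sakamoto2024.CyclotomicMainIdentityAt G p g`, clause by clause
(`cyclotomicMainIdentityAt_of_bcs`). Hence the BCS-SEED ROAD (`padicValRat_bsd_rank_zero_of_congruence_of_bcsSeed{,_sigma}`):
the `p`-part of BSD in analytic rank `0` for a target `W` of ANY reduction type at `p ≥ 5` (surjective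
`ρ̄_{W,p}`, Fouquet's Ass. 2.9 (2) as the `ΨSq_p` clause, Ass. 3.4 in Tate form `Assumption34TateAt p W`,
`L(W,1) ≠ 0`, `Ш(W)` finite) from ANY congruent partner `G` that is good ordinary at `p` with
`ρ_{G,p^n}` onto for all `n` — no condition on the rank of `G`, on its `L`-value, or on Steinberg primes
of either curve; level-compatible partners through (A′), level-raised partners (with
`Assumption34TateAt p G`) through (A′σ). The partner's irreducibility binder of (A′)/(A′σ) and of the
BCS fact is discharged from surjectivity at `n = 1` (private lemma; the tree's
`hasIrreducibleModPGaloisRep_of_hasSurjectiveModNGaloisRep`).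

HONEST FRAMING. Nothing is asserted: every theorem takes the Fouquet fact `(hA : …)` and the BCS fact
`(hBCS : …)` as explicit hypotheses, and the census-currency forms also modularity (`exists_isNewformOf`,
to name a newform of the partner). The chain is REFEREED at both ends as typed (Fouquet 2025, Tunisian
J. Math. 7; Burungale–Castella–Skinner, IMRN 2025) and inherits the referee flags the desks attach to
those two names — for Fouquet's Thm 4.1 the Thm 2.10 provenance dichotomy recorded in the ADDENDA of the
fact files (`@Fouquet-2.10-via-ColmezWang-PRE` exactly on the rows with `a_p(G)² ≡ 1 (mod p)`; add the
binder `¬ p ∣ a_p(G)² − 1` on the partner for a preprint-free chain), for BCS Thm 1.1.2 (b) whatever ARM P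
attaches to `burungale_castella_skinner_charIdeal_eq_padicLFunction_integral` (its proof runs through
Wan's three-variable divisibility, [Wan15] of the source). WEAKER than print exactly as (A′)/(A′σ) are;
never stronger. BSD is not advanced by this file; it re-routes an existing hypothesis to a second
refereed supplier. Consumers: cell `bsd-potss` K8-t′ (item stmt-BirchSwinnertonDyer-19618, the NO-SEED
and unit-less content rows of `L_{II*,5}`: a same-support congruent partner at `N_W/25` of rank `2`
now qualifies if it is ordinary at `5` with surjective `5`-adic tower), `bsd-addord` (additive potentially
ordinary targets, rank `0`).

## References
* [Fouquet2025EquivariantTNC] O. Fouquet, Tunisian J. Math. 7 (2025) 791–829 = arXiv:2501.07105: Thm 4.1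
  (1)⇒(2) (pp. 24–25), Thm 1.7 (2) (p. 7), Cor. 4.3 and the remark before it (p. 25 L39–L46), proof of
  Cor. 4.3 first half (p. 26 L20–L31), Ass. 2.9 / §2.4.1 (p. 15), Ass. 3.4 (pp. 22–23), §2.2 (p. 12).
* [BurungaleCastellaSkinner2025] A. Burungale, F. Castella, C. Skinner, IMRN 2025 no. 8, rnaf082 =
  arXiv:2405.00270v2, Thm 1.1.2 (b) (p. 2) and its proof (p. 10).
* [Kato2004Asterisque] K. Kato, Astérisque 295 (2004), §17.13 (pp. 279–280), Conj. 12.10 (p. 224),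
  (12.5.2) (p. 222). [SkinnerUrban2014] Thm 3.6.9 (p. 45) (the road this one complements).
* Tree: `Fouquet2025/CongruenceTransportFromSeedMainIdentity{,Sigma}.lean` ((A′), (A′σ)),
  `CyclotomicIwasawaMainTheoremIrreducibleIntegral.lean` (BCS (b)), `Sakamoto2024/KuriharaStructureAtThree.lean`
  (`CyclotomicMainIdentityAt`), `NonEisensteinPrimeOfSurjective.lean` (surjective ⇒ irreducible),
  `CuspFormLFunction.lean` (`exists_isNewformOf`).
-/

noncomputable section

open scoped Classical MatrixGroups ModularForm

namespace Literature.NumberTheory.EllipticCurves.Fouquet2025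

open WeierstrassCurve CongruenceSubgroup Literature.NumberTheory.EllipticCurves.ModularForms

/-! ## The partner's irreducibility from its surjective tower, and the BCS seed identity -/

/-- A curve whose mod-`p^n` representations are all surjective has irreducible `p`-torsion (the case
`n = 1`: a surjective `ρ̄_{E,p}` is irreducible, `hasIrreducibleModPGaloisRep_of_hasSurjectiveModNGaloisRep`).
Private bookkeeping: lets the census drop the separate `Irr` binder of the partner. [folklore] -/
private theorem hasIrreducibleModPGaloisRep_of_forall_hasSurjectiveModNGaloisRep_pow (G : WeierstrassCurve ℚ)
    [G.IsElliptic] (p : ℕ) [Fact p.Prime] (hbig : ∀ n : ℕ, G.HasSurjectiveModNGaloisRep (p ^ n : ℕ)) :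
    G.HasIrreducibleModPGaloisRep p := by
  haveI : NeZero (p : ℚ) := ⟨by exact_mod_cast (Fact.out : p.Prime).ne_zero⟩
  have h1 : G.HasSurjectiveModNGaloisRep (p : ℤ) := by simpa using hbig 1
  exact hasIrreducibleModPGaloisRep_of_hasSurjectiveModNGaloisRep G p h1

/-- **Burungale–Castella–Skinner 2025 Thm 1.1.2 (b) supplies the seed identity.** For `G` good ordinary at
`p ≥ 5` with `G[p]` irreducible and `ρ_{G,p^n}` onto for all `n`, the tree's BCS fact
`burungale_castella_skinner_charIdeal_eq_padicLFunction_integral` gives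
`Sakamoto2024.CyclotomicMainIdentityAt G p g` for every newform `g` of `G` — the two shapes coincide clause
by clause (`X(G/ℚ_∞)` torsion and `char_Λ X = (g₀)` with `ι g₀ = L_p(g, α_G)`, for every cyclotomic datum
matching the cyclotomic variable and every Selmer-dual datum). NO ramified Steinberg prime.
[cite: BurungaleCastellaSkinner2025, Thm 1.1.2 (b) (p. 2 of arXiv:2405.00270v2)] -/
theorem cyclotomicMainIdentityAt_of_bcs (G : WeierstrassCurve ℚ) [G.IsElliptic] [G.IsGloballyMinimal]
    (p : ℕ) [Fact p.Prime] (hBCS : burungale_castella_skinner_charIdeal_eq_padicLFunction_integral)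
    (hp : 5 ≤ p) (hgood : G.HasGoodReductionAtPrime p) (hord : ¬ (p : ℤ) ∣ G.frobeniusTrace p)
    (hirr : G.HasIrreducibleModPGaloisRep p) (hbig : ∀ n : ℕ, G.HasSurjectiveModNGaloisRep (p ^ n : ℕ))
    {N : ℕ} [NeZero N] (g : CuspForm (Gamma0 N) 2) (hg : IsNewformOf G g) :
    Sakamoto2024.CyclotomicMainIdentityAt G p g := by
  intro κ γ hκ hγ hγ' S
  exact hBCS G p κ γ g hp hgood hord hirr hbig hκ hγ hγ' hg S

/-- The same with the irreducibility binder discharged from the surjective tower.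
[cite: BurungaleCastellaSkinner2025, Thm 1.1.2 (b) (p. 2 of arXiv:2405.00270v2)] -/
theorem cyclotomicMainIdentityAt_of_bcs_of_tower (G : WeierstrassCurve ℚ) [G.IsElliptic] [G.IsGloballyMinimal]
    (p : ℕ) [Fact p.Prime] (hBCS : burungale_castella_skinner_charIdeal_eq_padicLFunction_integral)
    (hp : 5 ≤ p) (hgood : G.HasGoodReductionAtPrime p) (hord : ¬ (p : ℤ) ∣ G.frobeniusTrace p)
    (hbig : ∀ n : ℕ, G.HasSurjectiveModNGaloisRep (p ^ n : ℕ))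
    {N : ℕ} [NeZero N] (g : CuspForm (Gamma0 N) 2) (hg : IsNewformOf G g) :
    Sakamoto2024.CyclotomicMainIdentityAt G p g :=
  cyclotomicMainIdentityAt_of_bcs G p hBCS hp hgood hord
    (hasIrreducibleModPGaloisRep_of_forall_hasSurjectiveModNGaloisRep_pow G p hbig) hbig g hg

/-! ## The BCS-seed road, strict `Σ` (level-compatible partners): (A′) + BCS Thm 1.1.2 (b) -/

/-- **Fouquet Thm 4.1 (1) ⇒ (2) with the seed's assertion (1) from Burungale–Castella–Skinner — the
`p`-part of BSD in analytic rank `0` for a target of ANY reduction type at `p ≥ 5`, from a congruent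
good-ordinary partner with big `p`-adic image; newform of the partner named.** Granting the Fouquet fact
(A′) (`hA`) and the BCS fact (`hBCS`): for `W` (surjective `ρ̄_{W,p}`, `ΨSq_p` without root in `ℚ_p`,
`Assumption34TateAt p W`, `L(W,1) ≠ 0`, `Ш(W)` finite) and a partner `G` good ordinary at `p` with
`ρ_{G,p^n}` onto for all `n`, a newform `g` of `G`, `a_ℓ(W) ≡ a_ℓ(G) (mod p)` off `p·N_W·N_G` and every
bad prime `q ≠ p` of `G` dividing `N_W`: `v_p(L(W,1)/Ω_W) = v_p(#Ш(W)) + v_p(∏ c_ℓ(W)) − 2·v_p(#W(ℚ)_tors)`.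
No Steinberg-prime hypothesis and no `L`-value hypothesis on `G`. [cite: Fouquet2025EquivariantTNC, Thm 4.1 (1)⇒(2) (pp. 24–25), Thm 1.7 (2) (p. 7), remark before Cor. 4.3 (p. 25), proof of Cor. 4.3 first half (p. 26)]
[cite: BurungaleCastellaSkinner2025, Thm 1.1.2 (b) (p. 2 of arXiv:2405.00270v2)] -/
theorem padicValRat_bsd_rank_zero_of_congruence_of_bcsSeed_newform
    (hA : padicValRat_bsd_rank_zero_of_congruence_of_seedMainIdentity)
    (hBCS : burungale_castella_skinner_charIdeal_eq_padicLFunction_integral)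
    (W G : WeierstrassCurve ℚ) [W.IsElliptic] [W.IsGloballyMinimal] [G.IsElliptic] [G.IsGloballyMinimal]
    (p : ℕ) [Fact p.Prime] (hp : 5 ≤ p) (hsurj : W.HasSurjectiveModNGaloisRep p)
    (hΨ : ∀ x : ℚ_[p], ((W.baseChange ℚ_[p]).ΨSq (p : ℤ)).eval x ≠ 0)
    (h34W : Assumption34TateAt p W)
    (hGgood : G.HasGoodReductionAtPrime p) (hGord : ¬ (p : ℤ) ∣ G.frobeniusTrace p)
    (hGbig : ∀ n : ℕ, G.HasSurjectiveModNGaloisRep (p ^ n : ℕ))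
    {M : ℕ} [NeZero M] (g : CuspForm (Gamma0 M) 2) (hg : IsNewformOf G g)
    (hcong : ∀ ℓ : ℕ, ℓ.Prime → ¬ (ℓ ∣ p * W.conductorNorm ℤ * G.conductorNorm ℤ) →
      ((W.LFunction ℓ : ℤ) : ZMod p) = ((G.LFunction ℓ : ℤ) : ZMod p))
    (hlev : ∀ q : ℕ, q.Prime → q ≠ p → (q : ℤ) ∣ G.conductorNorm ℤ → (q : ℤ) ∣ W.conductorNorm ℤ)
    (hL : W.entireLFunction 1 ≠ 0) (hsha : Finite W.sha) :
    ∃ q : ℚ, W.entireLFunction 1 / (W.realPeriodRat : ℂ) = (q : ℂ) ∧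
      padicValRat p q = (padicValNat p W.shaOrder : ℤ) + padicValNat p W.tamagawaProduct -
        2 * padicValNat p W.torsionOrder := by
  have hGirr : G.HasIrreducibleModPGaloisRep p :=
    hasIrreducibleModPGaloisRep_of_forall_hasSurjectiveModNGaloisRep_pow G p hGbig
  have hid : Sakamoto2024.CyclotomicMainIdentityAt G p g :=
    cyclotomicMainIdentityAt_of_bcs G p hBCS hp hGgood hGord hGirr hGbig g hg
  exact hA W G p hp hsurj hΨ h34W hGgood hGord hGirr hGbig g hg hid hcong hlev hL hsha

/-- **The BCS-seed road in census currency (strict `Σ`).** As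
`padicValRat_bsd_rank_zero_of_congruence_of_bcsSeed_newform`, with the partner's newform supplied by
modularity (`exists_isNewformOf`, Breuil–Conrad–Diamond–Taylor), so that the per-row obligations are only:
`W` — `ρ̄_{W,p}` onto, `ΨSq_p` rootless over `ℚ_p`, `Assumption34TateAt p W`, `L(W,1) ≠ 0`, `Ш(W)` finite;
`G` — good at `p`, `p ∤ a_p(G)`, `ρ_{G,p^n}` onto for all `n`; the congruence off `p·N_W·N_G` and
`supp(N_G) ∖ {p} ⊆ supp(N_W)`. No rank, `L`-value or Steinberg condition on `G`.
[cite: Fouquet2025EquivariantTNC, Thm 4.1 (1)⇒(2) (pp. 24–25), Thm 1.7 (2) (p. 7), remark before Cor. 4.3 (p. 25)]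
[cite: BurungaleCastellaSkinner2025, Thm 1.1.2 (b) (p. 2 of arXiv:2405.00270v2)] [cite: DiamondShurman2005, Thm. 8.8.3] -/
theorem padicValRat_bsd_rank_zero_of_congruence_of_bcsSeed
    (hA : padicValRat_bsd_rank_zero_of_congruence_of_seedMainIdentity)
    (hBCS : burungale_castella_skinner_charIdeal_eq_padicLFunction_integral)
    (hmod : exists_isNewformOf)
    (W G : WeierstrassCurve ℚ) [W.IsElliptic] [W.IsGloballyMinimal] [G.IsElliptic] [G.IsGloballyMinimal]
    (p : ℕ) [Fact p.Prime] (hp : 5 ≤ p) (hsurj : W.HasSurjectiveModNGaloisRep p)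
    (hΨ : ∀ x : ℚ_[p], ((W.baseChange ℚ_[p]).ΨSq (p : ℤ)).eval x ≠ 0)
    (h34W : Assumption34TateAt p W)
    (hGgood : G.HasGoodReductionAtPrime p) (hGord : ¬ (p : ℤ) ∣ G.frobeniusTrace p)
    (hGbig : ∀ n : ℕ, G.HasSurjectiveModNGaloisRep (p ^ n : ℕ))
    (hcong : ∀ ℓ : ℕ, ℓ.Prime → ¬ (ℓ ∣ p * W.conductorNorm ℤ * G.conductorNorm ℤ) →
      ((W.LFunction ℓ : ℤ) : ZMod p) = ((G.LFunction ℓ : ℤ) : ZMod p))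
    (hlev : ∀ q : ℕ, q.Prime → q ≠ p → (q : ℤ) ∣ G.conductorNorm ℤ → (q : ℤ) ∣ W.conductorNorm ℤ)
    (hL : W.entireLFunction 1 ≠ 0) (hsha : Finite W.sha) :
    ∃ q : ℚ, W.entireLFunction 1 / (W.realPeriodRat : ℂ) = (q : ℂ) ∧
      padicValRat p q = (padicValNat p W.shaOrder : ℤ) + padicValNat p W.tamagawaProduct -
        2 * padicValNat p W.torsionOrder := by
  haveI : NeZero (G.conductorNorm ℤ) := ⟨(G.conductorNorm_pos_holds).ne'⟩
  obtain ⟨g, hg⟩ := hmod G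
  exact padicValRat_bsd_rank_zero_of_congruence_of_bcsSeed_newform hA hBCS W G p hp hsurj hΨ h34W
    hGgood hGord hGbig g hg hcong hlev hL hsha

/-! ## The BCS-seed road over `Σ = primes(p·N_W·N_G)` (level-raised partners): (A′σ) + BCS Thm 1.1.2 (b) -/

/-- **Level-raised partners: (A′σ) with the seed's assertion (1) from Burungale–Castella–Skinner, newform
named.** As `padicValRat_bsd_rank_zero_of_congruence_of_bcsSeed_newform`, with the level-compatibility binder
replaced by `Assumption34TateAt p G` (Fouquet's Ass. 3.4 in Tate form on the unramified Steinberg primes of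
the partner, which include its level-raising primes relative to `W`).
[cite: Fouquet2025EquivariantTNC, Thm 4.1 (1)⇒(2) (pp. 24–25), Thm 1.7 (2) (p. 7), remark before Cor. 4.3 (p. 25), Ass. 3.4 (pp. 22–23)]
[cite: BurungaleCastellaSkinner2025, Thm 1.1.2 (b) (p. 2 of arXiv:2405.00270v2)] -/
theorem padicValRat_bsd_rank_zero_of_congruence_of_bcsSeed_sigma_newform
    (hA : padicValRat_bsd_rank_zero_of_congruence_of_seedMainIdentity_sigma)
    (hBCS : burungale_castella_skinner_charIdeal_eq_padicLFunction_integral)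
    (W G : WeierstrassCurve ℚ) [W.IsElliptic] [W.IsGloballyMinimal] [G.IsElliptic] [G.IsGloballyMinimal]
    (p : ℕ) [Fact p.Prime] (hp : 5 ≤ p) (hsurj : W.HasSurjectiveModNGaloisRep p)
    (hΨ : ∀ x : ℚ_[p], ((W.baseChange ℚ_[p]).ΨSq (p : ℤ)).eval x ≠ 0)
    (h34W : Assumption34TateAt p W) (h34G : Assumption34TateAt p G)
    (hGgood : G.HasGoodReductionAtPrime p) (hGord : ¬ (p : ℤ) ∣ G.frobeniusTrace p)
    (hGbig : ∀ n : ℕ, G.HasSurjectiveModNGaloisRep (p ^ n : ℕ))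
    {M : ℕ} [NeZero M] (g : CuspForm (Gamma0 M) 2) (hg : IsNewformOf G g)
    (hcong : ∀ ℓ : ℕ, ℓ.Prime → ¬ (ℓ ∣ p * W.conductorNorm ℤ * G.conductorNorm ℤ) →
      ((W.LFunction ℓ : ℤ) : ZMod p) = ((G.LFunction ℓ : ℤ) : ZMod p))
    (hL : W.entireLFunction 1 ≠ 0) (hsha : Finite W.sha) :
    ∃ q : ℚ, W.entireLFunction 1 / (W.realPeriodRat : ℂ) = (q : ℂ) ∧
      padicValRat p q = (padicValNat p W.shaOrder : ℤ) + padicValNat p W.tamagawaProduct -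
        2 * padicValNat p W.torsionOrder := by
  have hGirr : G.HasIrreducibleModPGaloisRep p :=
    hasIrreducibleModPGaloisRep_of_forall_hasSurjectiveModNGaloisRep_pow G p hGbig
  have hid : Sakamoto2024.CyclotomicMainIdentityAt G p g :=
    cyclotomicMainIdentityAt_of_bcs G p hBCS hp hGgood hGord hGirr hGbig g hg
  exact hA W G p hp hsurj hΨ h34W hGgood hGord hGirr hGbig g hg hid hcong h34G hL hsha

/-- **The BCS-seed road over the enlarged `Σ` in census currency.** Per-row obligations: `W` —
`ρ̄_{W,p}` onto, `ΨSq_p` rootless over `ℚ_p`, `Assumption34TateAt p W`, `L(W,1) ≠ 0`, `Ш(W)` finite; `G` —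
good at `p`, `p ∤ a_p(G)`, `ρ_{G,p^n}` onto for all `n`, `Assumption34TateAt p G`; the congruence off
`p·N_W·N_G`. Modularity names the partner's newform. No rank, `L`-value, Steinberg or level condition on `G`.
[cite: Fouquet2025EquivariantTNC, Thm 4.1 (1)⇒(2) (pp. 24–25), Thm 1.7 (2) (p. 7), remark before Cor. 4.3 (p. 25), Ass. 3.4 (pp. 22–23)]
[cite: BurungaleCastellaSkinner2025, Thm 1.1.2 (b) (p. 2 of arXiv:2405.00270v2)] [cite: DiamondShurman2005, Thm. 8.8.3] -/
theorem padicValRat_bsd_rank_zero_of_congruence_of_bcsSeed_sigma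
    (hA : padicValRat_bsd_rank_zero_of_congruence_of_seedMainIdentity_sigma)
    (hBCS : burungale_castella_skinner_charIdeal_eq_padicLFunction_integral)
    (hmod : exists_isNewformOf)
    (W G : WeierstrassCurve ℚ) [W.IsElliptic] [W.IsGloballyMinimal] [G.IsElliptic] [G.IsGloballyMinimal]
    (p : ℕ) [Fact p.Prime] (hp : 5 ≤ p) (hsurj : W.HasSurjectiveModNGaloisRep p)
    (hΨ : ∀ x : ℚ_[p], ((W.baseChange ℚ_[p]).ΨSq (p : ℤ)).eval x ≠ 0)
    (h34W : Assumption34TateAt p W) (h34G : Assumption34TateAt p G)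
    (hGgood : G.HasGoodReductionAtPrime p) (hGord : ¬ (p : ℤ) ∣ G.frobeniusTrace p)
    (hGbig : ∀ n : ℕ, G.HasSurjectiveModNGaloisRep (p ^ n : ℕ))
    (hcong : ∀ ℓ : ℕ, ℓ.Prime → ¬ (ℓ ∣ p * W.conductorNorm ℤ * G.conductorNorm ℤ) →
      ((W.LFunction ℓ : ℤ) : ZMod p) = ((G.LFunction ℓ : ℤ) : ZMod p))
    (hL : W.entireLFunction 1 ≠ 0) (hsha : Finite W.sha) :
    ∃ q : ℚ, W.entireLFunction 1 / (W.realPeriodRat : ℂ) = (q : ℂ) ∧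
      padicValRat p q = (padicValNat p W.shaOrder : ℤ) + padicValNat p W.tamagawaProduct -
        2 * padicValNat p W.torsionOrder := by
  haveI : NeZero (G.conductorNorm ℤ) := ⟨(G.conductorNorm_pos_holds).ne'⟩
  obtain ⟨g, hg⟩ := hmod G
  exact padicValRat_bsd_rank_zero_of_congruence_of_bcsSeed_sigma_newform hA hBCS W G p hp hsurj hΨ
    h34W h34G hGgood hGord hGbig g hg hcong hL hsha

end Literature.NumberTheory.EllipticCurves.Fouquet2025

end
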